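import Mathlib
import Literature.Computability.AlgebraicComplexity.PermanentIrreducible
import Literature.Computability.AlgebraicComplexity.StandardFamiliesProofs

/-!
# Crux `DivisionGap.PerCofactorDegreeReduction` (stmt-ValiantsHypothesis-15046), line `Sketch` —
# stub `stub_squareDescent`: squares descend modulo the permanent

**Theorem (`stub_squareDescent`).** If `per_n ∣ ∑_t u_t ^ 2` in `ℝ[x_ij]` (`n × n` variables,
finitely many real polynomials `u_t`), then `per_n ∣ u_t` for every `t`.  This is the UNSQUARING
tool of the line: a sum of squares in the ideal `(per_n) ⊂ ℝ[x]` has every base in `(per_n)`,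
so degrees halve.

## Proof (purely algebraic, no real Nullstellensatz)

For `n = 0`, `per_0 = 1` (empty permanent).  For `n ≥ 1`, `per := per_n` is prime in `ℝ[x]`
(`perPoly_irreducible`, and `ℝ[x]` in finitely many variables is a UFD) and has degree exactly `1`
in the variable `X_e`, `e = (0, 0)` (`degreeOf_perPoly`).  Everything else holds for an arbitrary
prime `p ∈ ℝ[x]` of degree `1` in some variable `X_e` (`dvd_of_dvd_sum_sq`):
1. `p = X_e · a + b` with `a = p /ᵐ X_e`, `b = p %ᵐ X_e` both free of `X_e`
   (`MvPolynomial.divMonomial_add_modMonomial_single`), and `a ≠ 0` since `degreeOf e p = 1`.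
2. An `X_e`-free multiple of `p` is `0` (`X_e`-degrees add over a domain,
   `MvPolynomial.degreeOf_mul_eq`), so `p ∤ a`.
3. For every `u` there are `D` and an `X_e`-free `U` with `p ∣ a^D u − U` (induction on
   `degreeOf e u`: `u = X_e u₁ + u₀`, `a u ≡ a u₀ − b u₁ (mod p)` has smaller `X_e`-degree); the
   exponent `D` can be taken common to all `u_t` (multiply `U_t` by a power of `a`).
4. `∑ U_t² = a^{2D} ∑ u_t² − ∑ (a^D u_t − U_t)(a^D u_t + U_t)` is a multiple of `p` and is
   `X_e`-free, hence `∑_t U_t² = 0`.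
5. Over `ℝ` this forces `U_t = 0` (evaluate at every real point: a vanishing sum of real squares
   has vanishing terms; `MvPolynomial.funext`).
6. So `p ∣ a^D u_t`; `p` prime and `p ∤ a` give `p ∣ u_t`.

Leans on the tree only: `perPoly_irreducible`, `degreeOf_perPoly`; Mathlib.  No definitions.
-/

noncomputable section

-- `Summit.ValiantsHypothesis.ValiantsHypothesis.…` is the tree's mandated single-conjunct layout
-- (Problem = Summit), so the duplicated namespace component is intended.
set_option linter.dupNamespace false

namespace Summit.ValiantsHypothesis.ValiantsHypothesis.Theorems.DivisionGap.PerCofactorDegreeReduction.SquareDescent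

open MvPolynomial Literature.Computability.AlgebraicComplexity
open scoped BigOperators

/-! ### Division with remainder by one variable and `X_e`-degrees -/

section General

variable {σ : Type*} {R : Type*} [CommRing R]

/-- The remainder `p %ᵐ X_e` is free of `X_e`. [folklore] -/
theorem degreeOf_modMonomial_single (e : σ) (p : MvPolynomial σ R) :
    degreeOf e (p.modMonomial (Finsupp.single e 1)) = 0 := by
  apply Nat.eq_zero_of_le_zero
  rw [degreeOf_le_iff]
  intro m hm
  by_contra h
  have hle : Finsupp.single e 1 ≤ m := by
    rw [Finsupp.single_le_iff]
    omega
  exact (mem_support_iff.1 hm) (coeff_modMonomial_of_le p hle)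

/-- The quotient `p /ᵐ X_e` has `X_e`-degree one less than `p`. [folklore] -/
theorem degreeOf_divMonomial_single_le (e : σ) (p : MvPolynomial σ R) :
    degreeOf e (p.divMonomial (Finsupp.single e 1)) ≤ degreeOf e p - 1 := by
  rw [degreeOf_le_iff]
  intro m hm
  have hm' : Finsupp.single e 1 + m ∈ p.support := by
    rw [mem_support_iff] at hm ⊢
    rwa [coeff_divMonomial] at hm
  have := monomial_le_degreeOf e hm'
  rw [Finsupp.add_apply, Finsupp.single_eq_same] at this
  omega

/-- Step 2: over a domain, an `X_e`-free multiple of a polynomial of positive `X_e`-degree is `0`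
(`X_e`-degrees add). [folklore] -/
theorem eq_zero_of_dvd_of_degreeOf [IsDomain R] {e : σ} {p r : MvPolynomial σ R}
    (hp : degreeOf e p ≠ 0) (hr : degreeOf e r = 0) (hdvd : p ∣ r) : r = 0 := by
  obtain ⟨s, rfl⟩ := hdvd
  by_contra hne
  rw [degreeOf_mul_eq (left_ne_zero_of_mul hne) (right_ne_zero_of_mul hne)] at hr
  omega

/-- Step 3: if `p = X_e · a + b` with `a, b` free of `X_e`, then every `u` of `X_e`-degree `≤ N`
satisfies `p ∣ a ^ D · u - U` for some `D` and some `X_e`-free `U` (induction on `N`, using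
`a · X_e ≡ -b (mod p)`). [folklore] -/
theorem exists_pow_mul_sub_free {e : σ} {p a b : MvPolynomial σ R} (hp : X e * a + b = p)
    (ha : degreeOf e a = 0) (hb : degreeOf e b = 0) (N : ℕ) :
    ∀ u : MvPolynomial σ R, degreeOf e u ≤ N →
      ∃ (D : ℕ) (U : MvPolynomial σ R), degreeOf e U = 0 ∧ p ∣ a ^ D * u - U := by
  subst hp
  induction N with
  | zero =>
    intro u hu
    exact ⟨0, u, Nat.eq_zero_of_le_zero hu, by simp⟩
  | succ N ih =>
    intro u hu
    obtain ⟨u₁, u₀, hdec, hu₀, hu₁⟩ : ∃ u₁ u₀ : MvPolynomial σ R,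
        X e * u₁ + u₀ = u ∧ degreeOf e u₀ = 0 ∧ degreeOf e u₁ ≤ N :=
      ⟨_, _, u.divMonomial_add_modMonomial_single e, degreeOf_modMonomial_single e u, by
        have := degreeOf_divMonomial_single_le e u
        omega⟩
    subst hdec
    have hu' : degreeOf e (a * u₀ - b * u₁) ≤ N := by
      refine (degreeOf_sub_le _ _ _).trans (max_le ?_ ?_)
      · refine (degreeOf_mul_le _ _ _).trans ?_
        rw [ha, hu₀]
        exact Nat.zero_le _
      · refine (degreeOf_mul_le _ _ _).trans ?_
        rw [hb, zero_add]
        exact hu₁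
    obtain ⟨D, U, hU, hdvd⟩ := ih _ hu'
    refine ⟨D + 1, U, hU, ?_⟩
    have key : a ^ (D + 1) * (X e * u₁ + u₀) - U =
        a ^ D * u₁ * (X e * a + b) + (a ^ D * (a * u₀ - b * u₁) - U) := by
      ring
    rw [key]
    exact dvd_add (dvd_mul_left _ _) hdvd

/-- Step 3 with a common exponent: for a finite family `u_t` there are one `D` and `X_e`-free `U_t`
with `p ∣ a ^ D · u_t - U_t` for all `t`. [folklore] -/
theorem exists_common_pow {e : σ} {p a b : MvPolynomial σ R} (hp : X e * a + b = p)
    (ha : degreeOf e a = 0) (hb : degreeOf e b = 0) {ι : Type*} [Fintype ι]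
    (u : ι → MvPolynomial σ R) :
    ∃ (D : ℕ) (U : ι → MvPolynomial σ R),
      (∀ t, degreeOf e (U t) = 0) ∧ ∀ t, p ∣ a ^ D * u t - U t := by
  choose D U hU hdvd using
    fun t => exists_pow_mul_sub_free hp ha hb (degreeOf e (u t)) (u t) le_rfl
  refine ⟨∑ s, D s, fun t => a ^ (∑ s, D s - D t) * U t, fun t => ?_, fun t => ?_⟩
  · apply Nat.eq_zero_of_le_zero
    calc degreeOf e (a ^ (∑ s, D s - D t) * U t)
        ≤ degreeOf e (a ^ (∑ s, D s - D t)) + degreeOf e (U t) := degreeOf_mul_le _ _ _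
      _ ≤ (∑ s, D s - D t) * degreeOf e a + degreeOf e (U t) := by
          gcongr
          exact degreeOf_pow_le _ _ _
      _ = 0 := by rw [ha, hU, mul_zero]
  · have hle : D t ≤ ∑ s, D s :=
      Finset.single_le_sum (fun s _ => Nat.zero_le (D s)) (Finset.mem_univ t)
    obtain ⟨k, hk⟩ := Nat.exists_eq_add_of_le hle
    show p ∣ a ^ (∑ s, D s) * u t - a ^ (∑ s, D s - D t) * U t
    rw [hk, Nat.add_sub_cancel_left, pow_add]
    have key : a ^ D t * a ^ k * u t - a ^ k * U t = a ^ k * (a ^ D t * u t - U t) := by ring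
    rw [key]
    exact (hdvd t).mul_left _

/-- A sum of squares of `X_e`-free polynomials is `X_e`-free. [folklore] -/
theorem degreeOf_sum_sq_eq_zero {e : σ} {ι : Type*} (s : Finset ι) (U : ι → MvPolynomial σ R)
    (hU : ∀ t, degreeOf e (U t) = 0) : degreeOf e (∑ t ∈ s, U t ^ 2) = 0 := by
  apply Nat.eq_zero_of_le_zero
  refine (degreeOf_sum_le _ _ _).trans (Finset.sup_le fun t _ => ?_)
  calc degreeOf e (U t ^ 2) ≤ 2 * degreeOf e (U t) := degreeOf_pow_le _ _ _
    _ = 0 := by rw [hU, mul_zero]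

/-- Step 4: over a domain, if `p = X_e · a + b` (`a, b` free of `X_e`, `degreeOf e p ≠ 0`) divides
`∑_t u_t ^ 2`, then with the data of `exists_common_pow` the `X_e`-free multiple `∑_t U_t ^ 2` of
`p` vanishes. [folklore] -/
theorem sum_sq_eq_zero_of_dvd [IsDomain R] {e : σ} {p a b : MvPolynomial σ R}
    (hp : X e * a + b = p) (ha : degreeOf e a = 0) (hb : degreeOf e b = 0)
    (hpe : degreeOf e p ≠ 0) {ι : Type*} [Fintype ι] (u : ι → MvPolynomial σ R)
    (hdvd : p ∣ ∑ t, u t ^ 2) :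
    ∃ (D : ℕ) (U : ι → MvPolynomial σ R), (∀ t, p ∣ a ^ D * u t - U t) ∧ ∑ t, U t ^ 2 = 0 := by
  obtain ⟨D, U, hU, hdU⟩ := exists_common_pow hp ha hb u
  refine ⟨D, U, hdU, eq_zero_of_dvd_of_degreeOf hpe (degreeOf_sum_sq_eq_zero _ U hU) ?_⟩
  have key : ∑ t, U t ^ 2 =
      a ^ (2 * D) * ∑ t, u t ^ 2 - ∑ t, (a ^ D * u t - U t) * (a ^ D * u t + U t) := by
    rw [Finset.mul_sum, ← Finset.sum_sub_distrib]
    refine Finset.sum_congr rfl fun t _ => ?_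
    ring
  rw [key]
  exact dvd_sub (hdvd.mul_left _) (Finset.dvd_sum fun t _ => (hdU t).mul_right _)

end General

/-! ### Real coefficients -/

/-- Step 5: a vanishing sum of squares of real polynomials has vanishing terms (evaluate at every
real point; `MvPolynomial.funext`). [folklore] -/
theorem eq_zero_of_sum_sq_eq_zero {σ : Type*} {ι : Type*} [Fintype ι]
    (U : ι → MvPolynomial σ ℝ) (h : ∑ t, U t ^ 2 = 0) (t : ι) : U t = 0 := by
  apply MvPolynomial.funext
  intro x
  have hx := congrArg (eval x) h
  rw [map_sum, map_zero] at hx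
  simp only [map_pow] at hx
  rw [Finset.sum_eq_zero_iff_of_nonneg fun s _ => sq_nonneg (eval x (U s))] at hx
  rw [map_zero]
  exact (pow_eq_zero_iff two_ne_zero).1 (hx t (Finset.mem_univ t))

/-- Step 6: a prime `p ∈ ℝ[x]` of degree exactly `1` in some variable `X_e` that divides a sum of
squares divides every base. [folklore] -/
theorem dvd_of_dvd_sum_sq {σ : Type*} {p : MvPolynomial σ ℝ} (hprime : Prime p) {e : σ}
    (hpe : degreeOf e p = 1) {ι : Type*} [Fintype ι] (u : ι → MvPolynomial σ ℝ)
    (hdvd : p ∣ ∑ t, u t ^ 2) (t : ι) : p ∣ u t := by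
  obtain ⟨a, b, hp, ha, hb⟩ : ∃ a b : MvPolynomial σ ℝ,
      X e * a + b = p ∧ degreeOf e a = 0 ∧ degreeOf e b = 0 :=
    ⟨_, _, p.divMonomial_add_modMonomial_single e, by
      have := degreeOf_divMonomial_single_le e p
      omega, degreeOf_modMonomial_single e p⟩
  have hpe' : degreeOf e p ≠ 0 := by omega
  have ha0 : a ≠ 0 := by
    rintro rfl
    rw [mul_zero, zero_add] at hp
    rw [← hp, hb] at hpe
    exact zero_ne_one hpe
  have hpa : ¬ p ∣ a := fun h => ha0 (eq_zero_of_dvd_of_degreeOf hpe' ha h)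
  obtain ⟨D, U, hdU, hsum⟩ := sum_sq_eq_zero_of_dvd hp ha hb hpe' u hdvd
  have h1 : p ∣ a ^ D * u t := by
    have := hdU t
    rwa [eq_zero_of_sum_sq_eq_zero U hsum t, sub_zero] at this
  rcases hprime.dvd_or_dvd h1 with h | h
  · exact absurd (hprime.dvd_of_dvd_pow h) hpa
  · exact h

/-! ### The stub -/

/-- **stub_squareDescent — SQUARES DESCEND modulo the permanent.**  If a sum of squares of real
polynomials is a multiple of `per_n` then every base is: `per_n ∣ ∑_t u_t ^ 2 → per_n ∣ u_t`.
For `n = 0`, `per_0 = 1`; for `n ≥ 1`, `per_n` is prime in `ℝ[x]` (`perPoly_irreducible`, UFD) of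
degree `1` in `X_{(0,0)}` (`degreeOf_perPoly`), and `dvd_of_dvd_sum_sq` applies. [folklore] -/
theorem stub_squareDescent (n : ℕ) {ι : Type} [Fintype ι]
    (u : ι → MvPolynomial (Fin n × Fin n) ℝ)
    (hdvd : perPoly (Fin n) ℝ ∣ ∑ t, u t ^ 2) (t : ι) :
    perPoly (Fin n) ℝ ∣ u t := by
  rcases Nat.eq_zero_or_pos n with rfl | hn
  · have h1 : perPoly (Fin 0) ℝ = 1 := Matrix.permanent_isEmpty
    rw [h1]
    exact one_dvd _
  · haveI : Nonempty (Fin n) := ⟨⟨0, hn⟩⟩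
    have hprime : Prime (perPoly (Fin n) ℝ) :=
      UniqueFactorizationMonoid.irreducible_iff_prime.mp perPoly_irreducible
    exact dvd_of_dvd_sum_sq hprime (degreeOf_perPoly ℝ ((⟨0, hn⟩ : Fin n), (⟨0, hn⟩ : Fin n)))
      u hdvd t

end Summit.ValiantsHypothesis.ValiantsHypothesis.Theorems.DivisionGap.PerCofactorDegreeReduction.SquareDescent

end
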